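import Summits.CriticalPhenomena.Ising3DConformalLimit.Theorems.SynchronousCouplingDefs

/-!
# Line `SketchIdeator2` for the crux `SynchronousCoupling.RotationJoining` (stmt-CriticalPhenomena-18763) —
tool sub-goal `stub_measureExtOfLipschitz` (of `stub_qualitativeOfFDDIsotropy`)

Pure measure theory, no lattice content: two finite Borel measures on a pseudometric space whose integrals
of all bounded `1`-Lipschitz real functions agree are equal.

* `integral_eq_of_lipschitzWith_of_one`: rescaling by `max K 1` upgrades the hypothesis from bounded
  `1`-Lipschitz to bounded `K`-Lipschitz test functions.
* `measure_ext_of_forall_integral_lipschitz_eq`: the real-valued thickened indicators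
  `thickenedIndicator (1/(n+1)) F` of a closed set `F` are bounded and Lipschitz
  (`lipschitzWith_thickenedIndicator`), and their integrals tend to the measure of `F`
  (`MeasureTheory.tendsto_integral_thickenedIndicator_of_isClosed`); hence the two measures agree on closed
  sets, a π-system generating the Borel σ-algebra (`MeasureTheory.ext_of_generate_finite`, exactly as in
  Mathlib's `MeasureTheory.ext_of_forall_lintegral_eq_of_IsFiniteMeasure`).
* `stub_measureExtOfLipschitz`: the registered stub, the specialisation to probability measures on
  `Fin d → ℝ` (sup metric, product = Borel σ-algebra).

Helper file of the line `SketchIdeator2` (lead skeleton `Cruxes/RotationJoining/Lines/SketchIdeator2.lean`):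
proves the registered stub `stub_measureExtOfLipschitz` verbatim (name + signature).
No definitions, no named facts, no sorry.
-/

namespace Summit.CriticalPhenomena.Ising3DConformalLimit.Cruxes.RotationJoining.RateSplitting

open MeasureTheory Filter Topology

/-- If the integrals of all bounded `1`-Lipschitz real functions against two measures agree, then so do
the integrals of all bounded `K`-Lipschitz real functions (rescale the test function by `max K 1`). -/
theorem integral_eq_of_lipschitzWith_of_one {X : Type*} [PseudoMetricSpace X] [MeasurableSpace X]
    {P Q : Measure X}
    (h : ∀ f : X → ℝ, LipschitzWith 1 f → (∃ B, ∀ v, |f v| ≤ B) → ∫ v, f v ∂P = ∫ v, f v ∂Q)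
    {K : NNReal} {f : X → ℝ} (hf : LipschitzWith K f) (hb : ∃ B, ∀ v, |f v| ≤ B) :
    ∫ v, f v ∂P = ∫ v, f v ∂Q := by
  obtain ⟨B, hB⟩ := hb
  set c : ℝ := max (K : ℝ) 1 with hc_def
  have hc_pos : 0 < c := lt_of_lt_of_le one_pos (le_max_right _ _)
  have hg : LipschitzWith 1 (fun v => f v / c) := by
    refine LipschitzWith.mk_one fun x y => ?_
    rw [Real.dist_eq, ← sub_div, abs_div, abs_of_pos hc_pos, div_le_iff₀ hc_pos]
    calc |f x - f y| = dist (f x) (f y) := (Real.dist_eq _ _).symm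
      _ ≤ K * dist x y := hf.dist_le_mul x y
      _ ≤ c * dist x y := mul_le_mul_of_nonneg_right (le_max_left _ _) dist_nonneg
      _ = dist x y * c := mul_comm _ _
  have hgb : ∃ B', ∀ v, |f v / c| ≤ B' :=
    ⟨B / c, fun v => by
      rw [abs_div, abs_of_pos hc_pos]
      exact div_le_div_of_nonneg_right (hB v) hc_pos.le⟩
  have key := h _ hg hgb
  rw [integral_div, integral_div] at key
  exact (div_left_inj' hc_pos.ne').mp key

/-- Two finite Borel measures on a pseudometric space whose integrals of all bounded `1`-Lipschitz real
functions agree are equal: they agree on closed sets (outer approximation of the indicator of a closed set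
by Lipschitz thickened indicators), a π-system generating the Borel σ-algebra. -/
theorem measure_ext_of_forall_integral_lipschitz_eq {X : Type*} [PseudoMetricSpace X]
    [MeasurableSpace X] [BorelSpace X] {P Q : Measure X} [IsFiniteMeasure P] [IsFiniteMeasure Q]
    (h : ∀ f : X → ℝ, LipschitzWith 1 f → (∃ B, ∀ v, |f v| ≤ B) → ∫ v, f v ∂P = ∫ v, f v ∂Q) :
    P = Q := by
  have key : ∀ F : Set X, IsClosed F → P F = Q F := by
    intro F hF
    have hδ : ∀ n : ℕ, (0 : ℝ) < 1 / ((n : ℝ) + 1) := fun n => Nat.one_div_pos_of_nat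
    have hP := tendsto_integral_thickenedIndicator_of_isClosed P hF hδ
      tendsto_one_div_add_atTop_nhds_zero_nat
    have hQ := tendsto_integral_thickenedIndicator_of_isClosed Q hF hδ
      tendsto_one_div_add_atTop_nhds_zero_nat
    have heq : ∀ n : ℕ, ∫ ω, (thickenedIndicator (hδ n) F ω : ℝ) ∂P
        = ∫ ω, (thickenedIndicator (hδ n) F ω : ℝ) ∂Q := fun n =>
      integral_eq_of_lipschitzWith_of_one h
        (NNReal.isometry_coe.lipschitz.comp (lipschitzWith_thickenedIndicator (hδ n) F))
        ⟨1, fun v => by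
          rw [abs_of_nonneg (NNReal.coe_nonneg _)]
          exact_mod_cast thickenedIndicator_le_one (hδ n) F v⟩
    have hreal := tendsto_nhds_unique (hP.congr heq) hQ
    rw [measureReal_def, measureReal_def] at hreal
    exact (ENNReal.toReal_eq_toReal_iff' (measure_ne_top P F) (measure_ne_top Q F)).mp hreal
  apply ext_of_generate_finite _ ?_ isPiSystem_isClosed
  · exact fun F F_closed => key F F_closed
  · exact key _ isClosed_univ
  · rw [BorelSpace.measurable_eq (α := X), borel_eq_generateFrom_isClosed]

/-- L3 tool: two probability measures on `Fin d → ℝ` that integrate every bounded `1`-Lipschitz function equally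
are equal. -/
theorem stub_measureExtOfLipschitz :
    ∀ (d : ℕ) (P Q : Measure (Fin d → ℝ)) [IsProbabilityMeasure P] [IsProbabilityMeasure Q],
      (∀ f : (Fin d → ℝ) → ℝ, LipschitzWith 1 f → (∃ B, ∀ v, |f v| ≤ B) → ∫ v, f v ∂P = ∫ v, f v ∂Q) → P = Q :=
  fun _ _ _ _ _ h => measure_ext_of_forall_integral_lipschitz_eq h

end Summit.CriticalPhenomena.Ising3DConformalLimit.Cruxes.RotationJoining.RateSplitting
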